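import Mathlib
import Literature.Computability.AlgebraicComplexity.DeterminantalConormalBound

/-!
# Stub T3 `stub_twistNondegenerate` (crux `RefutationDegree.RefutationBarrier`, line `Sketch_ideator5`)

Multiplying a polynomial `f` by a polynomial `h` that does not vanish at a point `x` of the polar
set `T_f(a,b,c)` keeps `x` in the polar set of `h * f` and keeps it NON-DEGENERATE (bordered
Hessian invertible).  At `x` (where `f(x) = 0`) one has `∇(hf) = h ∇f` and
`∂ᵢ∂ⱼ(hf) = h ∂ᵢ∂ⱼf + ∂ᵢh ∂ⱼf + ∂ⱼh ∂ᵢf`; the determinant statement is proved through kernels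
(`Matrix.exists_mulVec_eq_zero_iff`): a kernel vector `(δ, σ, τ)` of the bordered Hessian of `hf`
yields the kernel vector `(h δ, σ + s κ, τ + t κ)`, `κ = ∇h · δ`, of the bordered Hessian of `f`.
-/

set_option linter.dupNamespace false

noncomputable section

namespace Summit.ValiantsHypothesis.ValiantsHypothesis.Theorems.RefutationDegree

open scoped BigOperators
open MvPolynomial Matrix
open Literature.Computability.AlgebraicComplexity (polarSet mem_polarSet)

/-- Linear-algebra core of `stub_twistNondegenerate`: if the bordered matrix
`[[F2, a, b], [F1ᵀ; cᵀ, 0]]` is invertible, `F1 = s a + t b` and `H ≠ 0`, then so is the bordered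
matrix `[[H F2 + H1 F1ᵀ + F1 H1ᵀ, a, b], [H F1ᵀ; cᵀ, 0]]` (kernel transport). [folklore] -/
private theorem det_twist_ne_zero {N : ℕ} (F2 : Fin N → Fin N → ℂ) (F1 H1 a b c : Fin N → ℂ)
    (H s t : ℂ) (hH : H ≠ 0) (hst : ∀ i, F1 i = s * a i + t * b i)
    (hdet : (Matrix.fromBlocks
        (Matrix.of fun i j : Fin N => F2 i j)
        (Matrix.of fun (i : Fin N) (l : Fin 2) => ![a i, b i] l)
        (Matrix.of fun (l : Fin 2) (j : Fin N) => ![F1 j, c j] l)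
        (0 : Matrix (Fin 2) (Fin 2) ℂ)).det ≠ 0) :
    (Matrix.fromBlocks
        (Matrix.of fun i j : Fin N => H * F2 i j + H1 i * F1 j + H1 j * F1 i)
        (Matrix.of fun (i : Fin N) (l : Fin 2) => ![a i, b i] l)
        (Matrix.of fun (l : Fin 2) (j : Fin N) => ![H * F1 j, c j] l)
        (0 : Matrix (Fin 2) (Fin 2) ℂ)).det ≠ 0 := by
  intro h0
  apply hdet
  obtain ⟨v, hv, hMv⟩ := Matrix.exists_mulVec_eq_zero_iff.mpr h0
  -- the rows of `M_{hf} v = 0`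
  have rowl : ∀ i, ∑ j, (H * F2 i j + H1 i * F1 j + H1 j * F1 i) * v (Sum.inl j) +
      (a i * v (Sum.inr 0) + b i * v (Sum.inr 1)) = 0 := by
    intro i
    have := congrFun hMv (Sum.inl i)
    simpa [Matrix.mulVec, dotProduct, Fintype.sum_sum_type, Fin.sum_univ_two] using this
  have row0 : ∑ j, H * F1 j * v (Sum.inl j) = 0 := by
    have := congrFun hMv (Sum.inr 0)
    simpa [Matrix.mulVec, dotProduct, Fintype.sum_sum_type, Fin.sum_univ_two] using this
  have row1 : ∑ j, c j * v (Sum.inl j) = 0 := by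
    have := congrFun hMv (Sum.inr 1)
    simpa [Matrix.mulVec, dotProduct, Fintype.sum_sum_type, Fin.sum_univ_two] using this
  have hgrad : ∑ j, F1 j * v (Sum.inl j) = 0 := by
    have : H * ∑ j, F1 j * v (Sum.inl j) = 0 := by
      rw [Finset.mul_sum]
      simpa [mul_assoc] using row0
    exact (mul_eq_zero.mp this).resolve_left hH
  set κ := ∑ j, H1 j * v (Sum.inl j) with hκ
  have rowl' : ∀ i, H * ∑ j, F2 i j * v (Sum.inl j) + a i * (v (Sum.inr 0) + s * κ) +
      b i * (v (Sum.inr 1) + t * κ) = 0 := by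
    intro i
    have e : ∑ j, (H * F2 i j + H1 i * F1 j + H1 j * F1 i) * v (Sum.inl j) =
        H * ∑ j, F2 i j * v (Sum.inl j) + H1 i * ∑ j, F1 j * v (Sum.inl j) + F1 i * κ := by
      simp only [hκ, Finset.mul_sum, ← Finset.sum_add_distrib]
      exact Finset.sum_congr rfl fun j _ => by ring
    have := rowl i
    rw [e, hgrad, hst i] at this
    linear_combination this
  refine Matrix.exists_mulVec_eq_zero_iff.mp
    ⟨Sum.elim (fun j => H * v (Sum.inl j)) ![v (Sum.inr 0) + s * κ, v (Sum.inr 1) + t * κ], ?_, ?_⟩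
  · -- the transported vector is nonzero
    intro hz
    apply hv
    have hδ : ∀ j, v (Sum.inl j) = 0 := fun j => by
      have := congrFun hz (Sum.inl j)
      simp only [Sum.elim_inl, Pi.zero_apply, mul_eq_zero] at this
      exact this.resolve_left hH
    have hκ0 : κ = 0 := by simp [hκ, hδ]
    have h0' := congrFun hz (Sum.inr 0)
    have h1' := congrFun hz (Sum.inr 1)
    simp only [Sum.elim_inr, Pi.zero_apply, Matrix.cons_val_zero, Matrix.cons_val_one,
      Matrix.cons_val_fin_one, hκ0, mul_zero, add_zero] at h0' h1'
    funext k
    rcases k with j | l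
    · exact hδ j
    · revert l
      rw [Fin.forall_fin_two]
      exact ⟨h0', h1'⟩
  · -- it lies in the kernel of `M_f`
    funext k
    rcases k with i | l
    · have := rowl' i
      rw [Finset.mul_sum] at this
      simp only [Matrix.mulVec, dotProduct, Fintype.sum_sum_type, Fin.sum_univ_two,
        Matrix.fromBlocks_apply₁₁, Matrix.fromBlocks_apply₁₂, Matrix.of_apply, Sum.elim_inl,
        Sum.elim_inr, Matrix.cons_val_zero, Matrix.cons_val_one, Matrix.cons_val_fin_one,
        Pi.zero_apply]
      rw [← this, add_assoc]
      congr 1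
      exact Finset.sum_congr rfl fun j _ => by ring
    · revert l
      rw [Fin.forall_fin_two]
      refine ⟨?_, ?_⟩
      · simp only [Matrix.mulVec, dotProduct, Fintype.sum_sum_type, Fin.sum_univ_two,
          Matrix.fromBlocks_apply₂₁, Matrix.fromBlocks_apply₂₂, Matrix.of_apply, Sum.elim_inl,
          Sum.elim_inr, Matrix.cons_val_zero, Pi.zero_apply, Matrix.zero_apply, zero_mul,
          add_zero]
        rw [← row0]
        exact Finset.sum_congr rfl fun j _ => by ring
      · simp only [Matrix.mulVec, dotProduct, Fintype.sum_sum_type, Fin.sum_univ_two,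
          Matrix.fromBlocks_apply₂₁, Matrix.fromBlocks_apply₂₂, Matrix.of_apply, Sum.elim_inl,
          Sum.elim_inr, Matrix.cons_val_one, Matrix.cons_val_fin_one, Pi.zero_apply,
          Matrix.zero_apply, zero_mul, add_zero]
        have : H * ∑ j, c j * v (Sum.inl j) = 0 := by rw [row1, mul_zero]
        rw [Finset.mul_sum] at this
        rw [← this]
        exact Finset.sum_congr rfl fun j _ => by ring

/-- **Stub T3 (twist non-degeneracy).**  If `x` is a non-degenerate polar point of `f` for the
datum `(a, b, c)` (bordered Hessian invertible) and `h(x) ≠ 0`, then `x` is a non-degenerate polar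
point of `h * f` for the same datum: at `x` one has `∇(hf) = h(x) ∇f` and
`∂ᵢ∂ⱼ(hf) = h ∂ᵢ∂ⱼ f + ∂ᵢh ∂ⱼf + ∂ⱼh ∂ᵢf`, and the bordered Hessian of `hf` has trivial kernel
because that of `f` has. -/
theorem stub_twistNondegenerate {N : ℕ} (f h : MvPolynomial (Fin N) ℂ) (a b c x : Fin N → ℂ)
    (hx : x ∈ polarSet f a b c)
    (hdet : (Matrix.fromBlocks
        (Matrix.of fun i j : Fin N => eval x (pderiv i (pderiv j f)))
        (Matrix.of fun (i : Fin N) (l : Fin 2) => ![a i, b i] l)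
        (Matrix.of fun (l : Fin 2) (j : Fin N) => ![eval x (pderiv j f), c j] l)
        (0 : Matrix (Fin 2) (Fin 2) ℂ)).det ≠ 0)
    (hh : eval x h ≠ 0) :
    x ∈ polarSet (h * f) a b c ∧
      (Matrix.fromBlocks
        (Matrix.of fun i j : Fin N => eval x (pderiv i (pderiv j (h * f))))
        (Matrix.of fun (i : Fin N) (l : Fin 2) => ![a i, b i] l)
        (Matrix.of fun (l : Fin 2) (j : Fin N) => ![eval x (pderiv j (h * f)), c j] l)
        (0 : Matrix (Fin 2) (Fin 2) ℂ)).det ≠ 0 := by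
  obtain ⟨hf0, ⟨i₀, hi₀⟩, ⟨s, t, hst⟩, hc⟩ := hx
  -- first derivatives of `h * f` at `x`
  have h1 : ∀ j, eval x (pderiv j (h * f)) = eval x h * eval x (pderiv j f) := by
    intro j
    simp only [pderiv_mul, map_add, map_mul, hf0, mul_zero, zero_add]
  -- second derivatives of `h * f` at `x`
  have h2 : ∀ i j, eval x (pderiv i (pderiv j (h * f))) =
      eval x h * eval x (pderiv i (pderiv j f)) + eval x (pderiv i h) * eval x (pderiv j f) +
        eval x (pderiv j h) * eval x (pderiv i f) := by
    intro i j
    simp only [pderiv_mul, map_add, map_mul, hf0, mul_zero, zero_add]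
    ring
  refine ⟨⟨?_, ⟨i₀, ?_⟩, ⟨eval x h * s, eval x h * t, fun i => ?_⟩, hc⟩, ?_⟩
  · simp only [map_mul, hf0, mul_zero]
  · rw [h1]
    exact mul_ne_zero hh hi₀
  · rw [h1, hst]
    ring
  · simp only [h1, h2]
    exact det_twist_ne_zero (fun i j => eval x (pderiv i (pderiv j f))) (fun j => eval x (pderiv j f))
      (fun j => eval x (pderiv j h)) a b c (eval x h) s t hh hst hdet

end Summit.ValiantsHypothesis.ValiantsHypothesis.Theorems.RefutationDegree
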